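import Literature.NumberTheory.Automorphic.UnitaryGroupTruncatedKernelClassIntegrableOfCusp
import Literature.NumberTheory.Automorphic.UnitaryGroupTruncatedKernelMeasurableTwo
import Literature.NumberTheory.Automorphic.UnitaryGroupEllipticCentralizerCompactTwo
import Literature.NumberTheory.Automorphic.UnitaryGroupBorelHeightBigCellTwo
import HarnessLib

/-!
# Integrability of the CLASS truncated kernels `k^T_𝔬` on `U(2)` REDUCED TO THE per-class CUSP ESTIMATE
# (the `N = 2` twin of ★ `UnitaryGroupTruncatedKernelClassIntegrableOfCusp` §§2–3)
(Rogawski, *Automorphic Representations of Unitary Groups in Three Variables* (1990), §2.2 p. 13: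
«Furthermore, `k^T_𝔬` is integrable over `𝐙G\𝐆`», with «`G = U(3)`, `U(2)`, or `U(2) × U(1)`», p. 98;
Arthur, Duke Math. J. 45 (1978), Thm. 7.1 — stated class by class; Gelbart (1975), §9.B for `GL₂`)

Topic `NumberTheory/Automorphic`; namespace `Literature.NumberTheory.Automorphic.UnitaryGroup`. Proof file:
theorems only (no definition, no named fact, no instance, no `sorry`). H-side copy of LAWS 1–5 for
`H = U(Φ₂) × U(Φ₁)` (hodgecm-mathlib, F0P3a LEAD WORD #123∕#124, census `CENSUS-LAWS-Hside` §3 LAW 1∕3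
«class rows first»; desk TABLE #1 row (H-L1-cusp)): the accepted ★ `UnitaryGroupTruncatedKernelClassIntegrableOfCusp`
has a rank-generic §1 (`exists_forall_norm_kernelClass_le`, every `N`, reused BY NAME) and `U(J₃)`-typed §§2–3;
this file re-types §§2–3 for the quasi-split `U(J₂)` of `E/F` (★ `quasiSplit F E c 2`) over the `U(J₂)` Siegel
property ★ `borelHeight_mul_lt_one_of_not_mem_arithmeticBorel_two` (★ `UnitaryGroupBorelHeightBigCellTwo`), the Mahler-region letter ★ `forall_inv_le_vecHeight_of_forall_borelHeight_le_two` (★ `UnitaryGroupEllipticCentralizerCompactTwo`) and the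
measurability letters ★ `UnitaryGroupTruncatedKernelMeasurableTwo`, proofs verbatim, names suffixed `_two`
(the involution hypothesis `c * c = 1` of the `N = 3` heads is not needed at `N = 2` and is dropped).
For an ARBITRARY class map `cl : G(F) → ι` with Rogawski's two partition axioms ★ `IsConjInvariant cl`,
★ `IsUnipotentInvariantOnBorel cl` (★ `UnitaryGroupArthurKernelClassExpansion`, every `N`), class kernels
`K_𝔬 = kernelClass cl i f`, `K_{B,𝔬} = kernelBorelClass ν 𝓕 cl i f`, `k^T_𝔬 = truncatedKernelClass ν 𝓕 T cl i f`.

* §1 `enorm_truncatedKernelClass_le_of_dichotomy_two` — THE POINTWISE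
  DICHOTOMY `‖k^T_𝔬(y)‖ ≤ C_T + Σ_{γ ∈ G(F)} (1_{D ∩ {H > T}} · ‖K_𝔬 − K_{B,𝔬}‖)(γ y)` (`T ≥ 1`): below the
  cut-off `k^T_𝔬 = K_𝔬` (★ `truncatedKernelClass_eq_kernelClass_of_forall_le`) on the Mahler region of level `T⁻¹`
  (★ `forall_inv_le_vecHeight_of_forall_borelHeight_le_two`, exported by ★ `UnitaryGroupEllipticCentralizerCompactTwo`:
  Godement's pairing inequality for anisotropic `ξ`, Witt ★ `exists_rational_lastRow_eq_smul_two` for isotropic ones); otherwise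
  ONE class `B(F)γ₀` is above the cut-off (Siegel property), `k^T_𝔬(y) = K_𝔬(z,z) − K_{B,𝔬}(z,z)` at `z = γ₀ y`
  (★ `kernelClass_diag_rational_mul`; ★ `kernelBorelClass_diag_rational_borel_mul` to move `z` into `D`).
* §2 **`integrable_quotFun_truncatedKernelClass_of_cusp_estimate_two`** — for ONE class `𝔬 = i`:
  `[g] ↦ k^T_𝔬(g⁻¹)` is `μ`-integrable for `T > T₀` as soon as (i) `U(J₂)(𝔸_F)` is unimodular (H-B2) and
  (ii) the per-class CUSP ESTIMATE `∫⁻_{D ∩ {T < H}} ‖K_𝔬 − K_{B,𝔬}‖ₑ dν_G < ∞` holds on some Borel `D` meeting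
  every `B(F)`-orbit (Weil's formula ★ `LevelOrbit.lintegral_fiberLIntegral_count_eq`, inversion invariance of
  `ν_G`; measurability ★ `aestronglyMeasurable_quotFun_truncatedKernelClass_two`). This is the LAW 1 closer
  skeleton at `N = 2`: a row pen proves only the per-class cusp estimate, and the total `k^T` follows by the
  finite class sum (★ `UnitaryGroupTruncatedKernelClassSumOfSupportTwo`).

HC_CM is proved only modulo the 7 printed citations until rung 0 closes.

## References

* J. D. Rogawski, *Automorphic Representations of Unitary Groups in Three Variables* (1990), §2.2 (p. 13),
  §7.3 (p. 98) [Rogawski1990].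
* S. Gelbart, *Automorphic forms on adele groups* (1975), §9.B [Gelbart1975].
* R. Godement, *Domaines fondamentaux des groupes arithmétiques*, Sém. Bourbaki 257 (1962/63), §1.1, §3
  [Godement1964].
-/

set_option autoImplicit false

noncomputable section

open MeasureTheory Measure NumberField IsDedekindDomain Set Matrix
open Literature.MeasureTheory.Group
open scoped NNReal ENNReal Pointwise

namespace Literature.NumberTheory.Automorphic

namespace UnitaryGroup

variable {F E : Type} [Field F] [NumberField F] [Field E] [NumberField E] [Algebra F E]
  {c : E ≃ₐ[F] E} {ι : Type*}

/-- `𝔸_E` is Hausdorff (local copy of the standard argument). [folklore] -/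
private theorem t2Space_adeleRing_E₁₂ : T2Space (AdeleRing (𝓞 E) E) := by
  haveI : T2Space (FiniteAdeleRing (𝓞 E) E) := inferInstanceAs <| T2Space
    (RestrictedProduct (fun w : IsDedekindDomain.HeightOneSpectrum (𝓞 E) => w.adicCompletion E)
      (fun w => (w.adicCompletionIntegers E : Set (w.adicCompletion E))) Filter.cofinite)
  haveI : T2Space (InfiniteAdeleRing E) :=
    inferInstanceAs <| T2Space ((w : InfinitePlace E) → w.Completion)
  exact inferInstanceAs <| T2Space (InfiniteAdeleRing E × FiniteAdeleRing (𝓞 E) E)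

/-! ## §1 The pointwise dichotomy for `k^T_𝔬` on `U(2)` -/

section Two

variable [MeasurableSpace (adelicUnipotent F E c 2)] [BorelSpace (adelicUnipotent F E c 2)]

/-- **THE POINTWISE DICHOTOMY BOUND, class by class** (`cl` with Rogawski's two partition axioms,
`T ≥ 1`, `ν` Haar, `𝓕` a fundamental domain of `N(F)`, `C` a bound for `|K_𝔬(y, y)|` on the Mahler region
of level `T⁻¹`, `D` meeting every `B(F)`-orbit): `‖k^T_𝔬(y)‖ ≤ C + Σ'_{γ ∈ G(F)} (1_{D ∩ {H > T}} ‖K_𝔬 − K_{B,𝔬}‖)(γ y)`.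
[cite: Rogawski1990, §2.2 (p. 13)] -/
theorem enorm_truncatedKernelClass_le_of_dichotomy_two (ν : Measure (adelicUnipotent F E c 2))
    [ν.IsHaarMeasure] {𝓕 : Set (adelicUnipotent F E c 2)}
    (h𝓕 : IsFundamentalDomain (rationalUnipotent F E c 2) 𝓕 ν)
    {cl : (quasiSplit F E c 2).arithmeticSubgroup → ι} (hcl : IsConjInvariant cl)
    (hclN : IsUnipotentInvariantOnBorel F E c 2 cl) (i : ι)
    (f : (quasiSplit F E c 2).Adelic → ℂ) {T : ℝ≥0} (hT : 1 ≤ T) {C : ℝ}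
    (hC : ∀ g : (quasiSplit F E c 2).Adelic,
      (∀ ξ : Fin 2 → E, ξ ≠ 0 →
        T⁻¹ ≤ vecHeight E (principalVec E ξ ᵥ* (adelicVal F E c 2 _ g : Matrix (Fin 2) (Fin 2) (AdeleRing (𝓞 E) E)))) →
      ‖kernelClass cl i f g g‖ ≤ C)
    {D : Set (quasiSplit F E c 2).Adelic}
    (hD : ∀ g : (quasiSplit F E c 2).Adelic, ∃ β : (quasiSplit F E c 2).arithmeticSubgroup,
      β ∈ arithmeticBorel F E c 2 ∧ (β : (quasiSplit F E c 2).Adelic) * g ∈ D)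
    (y : (quasiSplit F E c 2).Adelic) :
    ‖truncatedKernelClass ν 𝓕 T cl i f y‖ₑ ≤ ENNReal.ofReal C +
      ∑' γ : (quasiSplit F E c 2).arithmeticSubgroup,
        (D ∩ {g | T < borelHeight g}).indicator
          (fun g => (‖kernelClass cl i f g g - kernelBorelClass ν 𝓕 cl i f g g‖ₑ : ℝ≥0∞))
          ((γ : (quasiSplit F E c 2).Adelic) * y) := by
  classical
  by_cases hex : ∃ γ : (quasiSplit F E c 2).arithmeticSubgroup,
      T < borelHeight ((γ : (quasiSplit F E c 2).Adelic) * y)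
  · -- exactly one class above the cut-off
    obtain ⟨γ₀, hγ₀⟩ := hex
    have hT1 : 1 < borelHeight ((γ₀ : (quasiSplit F E c 2).Adelic) * y) := lt_of_le_of_lt hT hγ₀
    set q₀ : Quotient (QuotientGroup.rightRel (arithmeticBorel F E c 2)) := Quotient.mk _ γ₀ with hq₀
    have huniq : ∀ q : Quotient (QuotientGroup.rightRel (arithmeticBorel F E c 2)),
        T < borelHeight (((q.out : (quasiSplit F E c 2).arithmeticSubgroup) : (quasiSplit F E c 2).Adelic) * y) →
          q = q₀ := by
      intro q hq
      set δ : (quasiSplit F E c 2).arithmeticSubgroup := q.out * γ₀⁻¹ with hδ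
      have hqout : ((q.out : (quasiSplit F E c 2).arithmeticSubgroup) : (quasiSplit F E c 2).Adelic) * y =
          (δ : (quasiSplit F E c 2).Adelic) * (((γ₀ : (quasiSplit F E c 2).Adelic)) * y) := by
        rw [hδ, Subgroup.coe_mul, Subgroup.coe_inv]; group
      have hδB : δ ∈ arithmeticBorel F E c 2 := by
        by_contra hδB
        have hlt := borelHeight_mul_lt_one_of_not_mem_arithmeticBorel_two hδB hT1
        rw [← hqout] at hlt
        exact absurd (hT.trans hq.le) (not_le.2 hlt)
      rw [hq₀]
      rw [← Quotient.out_eq q]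
      exact Quotient.sound (QuotientGroup.rightRel_apply.2 (by
        rw [show γ₀ * (q.out : (quasiSplit F E c 2).arithmeticSubgroup)⁻¹ = δ⁻¹ by
          rw [hδ, _root_.mul_inv_rev, inv_inv]]
        exact inv_mem hδB))
    set z : (quasiSplit F E c 2).Adelic :=
      ((q₀.out : (quasiSplit F E c 2).arithmeticSubgroup) : (quasiSplit F E c 2).Adelic) * y with hz
    have hβ₀ : (q₀.out : (quasiSplit F E c 2).arithmeticSubgroup) * γ₀⁻¹ ∈ arithmeticBorel F E c 2 := by
      have h : @Setoid.r _ (QuotientGroup.rightRel (arithmeticBorel F E c 2)) q₀.out γ₀ :=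
        Quotient.mk_out (s := QuotientGroup.rightRel (arithmeticBorel F E c 2)) γ₀
      have h' := QuotientGroup.rightRel_apply.1 h
      rw [show (q₀.out : (quasiSplit F E c 2).arithmeticSubgroup) * γ₀⁻¹ =
        (γ₀ * (q₀.out : (quasiSplit F E c 2).arithmeticSubgroup)⁻¹)⁻¹ by rw [_root_.mul_inv_rev, inv_inv]]
      exact inv_mem h'
    have hzT : T < borelHeight z := by
      have hz' : z = (((q₀.out * γ₀⁻¹ : (quasiSplit F E c 2).arithmeticSubgroup)) : (quasiSplit F E c 2).Adelic) *
          (((γ₀ : (quasiSplit F E c 2).Adelic)) * y) := by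
        rw [hz, Subgroup.coe_mul, Subgroup.coe_inv]; group
      obtain ⟨b₀, hb₀⟩ := MonoidHom.mem_range.mp (q₀.out * γ₀⁻¹).2
      rw [hz', ← hb₀, borelHeight_rational_borel_mul b₀ (by
        rw [hb₀]; exact (mem_arithmeticBorel_iff _).1 hβ₀)]
      exact hγ₀
    -- `k^T_𝔬(y) = K_𝔬(y,y) − K_{B,𝔬}(z,z) = K_𝔬(z,z) − K_{B,𝔬}(z,z)`
    have hsum : pseudoEisenstein (kernelBorelTailClass ν 𝓕 T cl i f) y = kernelBorelClass ν 𝓕 cl i f z z := by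
      rw [pseudoEisenstein_def, finsum_eq_single _ q₀]
      · exact kernelBorelTailClass_of_lt cl i f hzT
      · intro q hq
        by_contra hne
        have hlt : T < borelHeight (((q.out : (quasiSplit F E c 2).arithmeticSubgroup) :
            (quasiSplit F E c 2).Adelic) * y) := by
          by_contra hle
          exact hne (kernelBorelTailClass_of_not_lt cl i f hle)
        exact hq (huniq q hlt)
    have hkT : truncatedKernelClass ν 𝓕 T cl i f y = kernelClass cl i f z z - kernelBorelClass ν 𝓕 cl i f z z := by
      rw [truncatedKernelClass_def, hsum, hz, kernelClass_diag_rational_mul hcl]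
    obtain ⟨β, hβB, hβD⟩ := hD z
    have hzβ : kernelClass cl i f z z - kernelBorelClass ν 𝓕 cl i f z z =
        kernelClass cl i f ((β : (quasiSplit F E c 2).Adelic) * z) ((β : (quasiSplit F E c 2).Adelic) * z) -
          kernelBorelClass ν 𝓕 cl i f ((β : (quasiSplit F E c 2).Adelic) * z)
            ((β : (quasiSplit F E c 2).Adelic) * z) := by
      rw [kernelClass_diag_rational_mul hcl i f β z z,
        kernelBorelClass_diag_rational_borel_mul hcl hclN ν h𝓕 i f β hβB z]
    have hβzT : T < borelHeight ((β : (quasiSplit F E c 2).Adelic) * z) := by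
      obtain ⟨b, hb⟩ := MonoidHom.mem_range.mp β.2
      rw [← hb, borelHeight_rational_borel_mul b (by rw [hb]; exact (mem_arithmeticBorel_iff _).1 hβB)]
      exact hzT
    set γ' : (quasiSplit F E c 2).arithmeticSubgroup := β * q₀.out with hγ'
    have hγ'y : (γ' : (quasiSplit F E c 2).Adelic) * y = (β : (quasiSplit F E c 2).Adelic) * z := by
      rw [hγ', Subgroup.coe_mul, hz, mul_assoc]
    have hterm : (‖truncatedKernelClass ν 𝓕 T cl i f y‖ₑ : ℝ≥0∞) =
        (D ∩ {g | T < borelHeight g}).indicator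
          (fun g => (‖kernelClass cl i f g g - kernelBorelClass ν 𝓕 cl i f g g‖ₑ : ℝ≥0∞))
          ((γ' : (quasiSplit F E c 2).Adelic) * y) := by
      rw [hγ'y, Set.indicator_of_mem (Set.mem_inter hβD hβzT), hkT, hzβ]
    calc (‖truncatedKernelClass ν 𝓕 T cl i f y‖ₑ : ℝ≥0∞)
        ≤ ∑' γ : (quasiSplit F E c 2).arithmeticSubgroup,
            (D ∩ {g | T < borelHeight g}).indicator
              (fun g => (‖kernelClass cl i f g g - kernelBorelClass ν 𝓕 cl i f g g‖ₑ : ℝ≥0∞))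
              ((γ : (quasiSplit F E c 2).Adelic) * y) := by rw [hterm]; exact ENNReal.le_tsum γ'
      _ ≤ _ := le_add_self
  · -- no class above the cut-off: `k^T_𝔬 = K_𝔬` and `y` in the Mahler region
    rw [not_exists] at hex
    have hle : ∀ γ : (quasiSplit F E c 2).arithmeticSubgroup,
        borelHeight ((γ : (quasiSplit F E c 2).Adelic) * y) ≤ T := fun γ => not_lt.1 (hex γ)
    rw [truncatedKernelClass_eq_kernelClass_of_forall_le cl i f hle]
    have hK : ‖kernelClass cl i f y y‖ ≤ C := hC y (forall_inv_le_vecHeight_of_forall_borelHeight_le_two hT hle)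
    calc (‖kernelClass cl i f y y‖ₑ : ℝ≥0∞) ≤ ENNReal.ofReal C := by
          rw [← ofReal_norm]; exact ENNReal.ofReal_le_ofReal hK
      _ ≤ _ := le_self_add

end Two

/-! ## §2 The assembly modulo the per-class cusp estimate -/

/-- **INTEGRABILITY OF `k^T_𝔬` FROM THE per-class CUSP ESTIMATE** (Rogawski (1990), §2.2 p. 13: «`k^T_𝔬` is
integrable over `𝐙G\𝐆`»; Arthur (1978), Thm. 7.1): for `cl` with Rogawski's two partition axioms and ONE class
`𝔬 = i`, for every Haar `ν` on `N(𝔸_F)`, fundamental domain `𝓕` of `N(F)`, automorphic `μ` and test `f`, the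
descended `[g] ↦ k^T_𝔬(g⁻¹)` is `μ`-integrable for `T > T₀`, provided (i) `U(J₂)(𝔸_F)` is unimodular and
(ii) the per-class cusp estimate `∫⁻_{D ∩ {T < H}} ‖K_𝔬(g,g) − K_{B,𝔬}(g,g)‖ₑ dν_G < ∞` on a Borel `D`
meeting every `B(F)`-orbit. [cite: Rogawski1990, §2.2 (p. 13)] [cite: Gelbart1975, §9.B (9.44)–(9.46)] -/
theorem integrable_quotFun_truncatedKernelClass_of_cusp_estimate_two
    (hunimod : ∀ [MeasurableSpace (quasiSplit F E c 2).Adelic] [BorelSpace (quasiSplit F E c 2).Adelic]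
      (νG : Measure (quasiSplit F E c 2).Adelic), νG.IsHaarMeasure → νG.IsMulRightInvariant)
    {cl : (quasiSplit F E c 2).arithmeticSubgroup → ι} (hcl : IsConjInvariant cl)
    (hclN : IsUnipotentInvariantOnBorel F E c 2 cl) (i : ι)
    (hcusp : ∀ [MeasurableSpace (adelicUnipotent F E c 2)] [BorelSpace (adelicUnipotent F E c 2)]
      [MeasurableSpace (quasiSplit F E c 2).Adelic] [BorelSpace (quasiSplit F E c 2).Adelic]
      (νG : Measure (quasiSplit F E c 2).Adelic) [νG.IsHaarMeasure]
      (ν : Measure (adelicUnipotent F E c 2)) [ν.IsHaarMeasure] (𝓕 : Set (adelicUnipotent F E c 2)),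
      IsFundamentalDomain (rationalUnipotent F E c 2) 𝓕 ν →
      ∀ (f : (quasiSplit F E c 2).Adelic → ℂ), IsQuasiSplitTest F E c 2 f →
      ∃ T₁ : ℝ≥0, ∀ T : ℝ≥0, T₁ < T → ∃ D : Set (quasiSplit F E c 2).Adelic, MeasurableSet D ∧
        (∀ g : (quasiSplit F E c 2).Adelic, ∃ β : (quasiSplit F E c 2).arithmeticSubgroup,
          β ∈ arithmeticBorel F E c 2 ∧ (β : (quasiSplit F E c 2).Adelic) * g ∈ D) ∧
        ∫⁻ g in D ∩ {g | T < borelHeight g},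
          ‖kernelClass cl i f g g - kernelBorelClass ν 𝓕 cl i f g g‖ₑ ∂νG < ∞)
    [MeasurableSpace (adelicUnipotent F E c 2)] [BorelSpace (adelicUnipotent F E c 2)]
    (ν : Measure (adelicUnipotent F E c 2)) [ν.IsHaarMeasure]
    {𝓕 : Set (adelicUnipotent F E c 2)} (h𝓕 : IsFundamentalDomain (rationalUnipotent F E c 2) 𝓕 ν)
    (μ : Measure (quasiSplit F E c 2).automorphicQuotient) [(quasiSplit F E c 2).IsAutomorphicMeasure μ]
    {f : (quasiSplit F E c 2).Adelic → ℂ} (hf : IsQuasiSplitTest F E c 2 f) :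
    ∃ T₀ : ℝ≥0, ∀ T : ℝ≥0, T₀ < T →
      Integrable ((quasiSplit F E c 2).quotFun (truncatedKernelClass ν 𝓕 T cl i f)) μ := by
  classical
  haveI := secondCountableTopology_adeleRing E
  haveI := locallyCompactSpace_adeleRing' E
  haveI := t2Space_adeleRing_E₁₂ (E := E)
  haveI : T2Space (quasiSplit F E c 2).Adelic :=
    inferInstanceAs (T2Space (adelic F E c 2 ((StdForm.antidiagonal 2).over E)))
  haveI : LocallyCompactSpace (quasiSplit F E c 2).Adelic :=
    inferInstanceAs (LocallyCompactSpace (adelic F E c 2 ((StdForm.antidiagonal 2).over E)))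
  haveI : SecondCountableTopology (quasiSplit F E c 2).Adelic :=
    inferInstanceAs (SecondCountableTopology (adelic F E c 2 ((StdForm.antidiagonal 2).over E)))
  letI : MeasurableSpace (quasiSplit F E c 2).Adelic := borel _
  haveI : BorelSpace (quasiSplit F E c 2).Adelic := ⟨rfl⟩
  obtain ⟨K₀⟩ := (inferInstance : Nonempty (TopologicalSpace.PositiveCompacts (quasiSplit F E c 2).Adelic))
  set νG : Measure (quasiSplit F E c 2).Adelic := Measure.haarMeasure K₀ with hνG
  haveI : νG.IsMulRightInvariant := hunimod νG inferInstance
  haveI : νG.IsInvInvariant := isInvInvariant_of_isMulRightInvariant νG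
  have hfc : Continuous f := hf.continuous'
  have hfs : HasCompactSupport f := hf.hasCompactSupport'
  obtain ⟨T₁, hT₁⟩ := hcusp νG ν 𝓕 h𝓕 f hf
  refine ⟨max T₁ 1, fun T hT => ?_⟩
  have hT1 : 1 ≤ T := (le_max_right T₁ 1).trans hT.le
  have hT0 : 0 < T := lt_of_lt_of_le zero_lt_one hT1
  obtain ⟨D, hDm, hDcov, hDint⟩ := hT₁ T ((le_max_left T₁ 1).trans_lt hT)
  obtain ⟨Cb, hCb⟩ := exists_forall_norm_kernelClass_le (F := F) (E := E) (c := c) (N := 2) (ι := ι)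
    (ε := T⁻¹) (inv_pos.2 hT0) hfc hfs
  have hNcl : IsClosed ((adelicUnipotent F E c 2 : Set (quasiSplit F E c 2).Adelic)) := by
    change IsClosed (⇑(adelicVal F E c 2 ((StdForm.antidiagonal 2).over E)) ⁻¹'
      ((upperUnitriangular (Fin 2) (AdeleRing (𝓞 E) E) : Subgroup (GL (Fin 2) (AdeleRing (𝓞 E) E))) :
        Set (GL (Fin 2) (AdeleRing (𝓞 E) E))))
    exact (isClosed_upperUnitriangular (R := AdeleRing (𝓞 E) E)).preimage continuous_subtype_val
  haveI : SecondCountableTopology (adelicUnipotent F E c 2) := TopologicalSpace.Subtype.secondCountableTopology _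
  haveI : LocallyCompactSpace (adelicUnipotent F E c 2) := hNcl.locallyCompactSpace
  haveI : SFinite ν := inferInstance
  set Dψ : (quasiSplit F E c 2).Adelic → ℝ≥0∞ := (D ∩ {g | T < borelHeight g}).indicator
    fun g => (‖kernelClass cl i f g g - kernelBorelClass ν 𝓕 cl i f g g‖ₑ : ℝ≥0∞) with hDψ
  have hDψm : Measurable Dψ := by
    have hk : Measurable fun g : (quasiSplit F E c 2).Adelic => kernelClass cl i f g g :=
      measurable_kernelClass_diag cl i hfc
    exact ((hk.sub (measurable_kernelBorelClass_diag hfc ν 𝓕 cl i)).enorm).indicator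
      (hDm.inter (measurableSet_setOf_lt_borelHeight T))
  haveI hΓd : DiscreteTopology (quasiSplit F E c 2).quotientSubgroup := by
    rw [quotientSubgroup_quasiSplit]; exact isDiscreteRational_quasiSplit
  set eΓ : (quasiSplit F E c 2).quotientSubgroup ≃ (quasiSplit F E c 2).arithmeticSubgroup :=
    (MulEquiv.subgroupCongr (quotientSubgroup_quasiSplit (F := F) (E := E) (c := c) (N := 2))).toEquiv with heΓ
  have hpt : ∀ y : (quasiSplit F E c 2).Adelic, (‖truncatedKernelClass ν 𝓕 T cl i f y‖ₑ : ℝ≥0∞) ≤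
      ENNReal.ofReal Cb + ∑' γ : (quasiSplit F E c 2).quotientSubgroup,
        Dψ ((γ : (quasiSplit F E c 2).Adelic) * y) := by
    intro y
    have h := enorm_truncatedKernelClass_le_of_dichotomy_two ν h𝓕 hcl hclN i f hT1 (hCb cl i) hDcov y
    have hre : ∑' γ : (quasiSplit F E c 2).arithmeticSubgroup, Dψ ((γ : (quasiSplit F E c 2).Adelic) * y) =
        ∑' γ : (quasiSplit F E c 2).quotientSubgroup, Dψ ((γ : (quasiSplit F E c 2).Adelic) * y) := by
      rw [← eΓ.tsum_eq]; rfl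
    rw [← hre]
    exact h
  letI : MeasurableSpace ((quasiSplit F E c 2).Adelic ⧸ (quasiSplit F E c 2).quotientSubgroup) :=
    AdelicGroupData.measurableSpaceQuotientForm (quasiSplit F E c 2)
  haveI : BorelSpace ((quasiSplit F E c 2).Adelic ⧸ (quasiSplit F E c 2).quotientSubgroup) :=
    AdelicGroupData.borelSpaceQuotientForm (quasiSplit F E c 2)
  haveI : SMulInvariantMeasure (quasiSplit F E c 2).Adelic
      ((quasiSplit F E c 2).Adelic ⧸ (quasiSplit F E c 2).quotientSubgroup) μ :=
    AdelicGroupData.smulInvariantMeasureQuotientForm (quasiSplit F E c 2) μ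
  haveI : @IsFiniteMeasureOnCompacts ((quasiSplit F E c 2).Adelic ⧸ (quasiSplit F E c 2).quotientSubgroup) _ _ μ :=
    AdelicGroupData.isFiniteMeasureOnCompactsQuotientForm (quasiSplit F E c 2) μ
  have hfib : ∀ x : (quasiSplit F E c 2).automorphicQuotient,
      ∑' γ : (quasiSplit F E c 2).quotientSubgroup,
          Dψ ((γ : (quasiSplit F E c 2).Adelic) * (Quotient.out x)⁻¹) =
        fiberLIntegral (quasiSplit F E c 2).quotientSubgroup count (Dψ ∘ fun g => g⁻¹) x := by
    intro x
    conv_rhs => rw [← QuotientGroup.out_eq' x]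
    rw [LevelOrbit.fiberLIntegral_count_mk]
    rw [← (Equiv.inv (quasiSplit F E c 2).quotientSubgroup).tsum_eq]
    refine tsum_congr fun γ => ?_
    simp only [Equiv.inv_apply, Function.comp_apply, Subgroup.coe_inv, _root_.mul_inv_rev]
  have hqf : ∀ x : (quasiSplit F E c 2).automorphicQuotient,
      (quasiSplit F E c 2).quotFun (truncatedKernelClass ν 𝓕 T cl i f) x =
        truncatedKernelClass ν 𝓕 T cl i f (Quotient.out x)⁻¹ := by
    intro x
    have h := quotFun_truncatedKernelClass_toAutomorphicQuotient' hcl hclN ν h𝓕 T i f (Quotient.out x)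
    rw [show (quasiSplit F E c 2).toAutomorphicQuotient (Quotient.out x) = x from QuotientGroup.out_eq' x] at h
    exact h
  have hlin : ∫⁻ x, (‖(quasiSplit F E c 2).quotFun (truncatedKernelClass ν 𝓕 T cl i f) x‖ₑ : ℝ≥0∞) ∂μ ≤
      ENNReal.ofReal Cb * μ Set.univ +
        unfoldingConstant (quasiSplit F E c 2).quotientSubgroup count μ νG *
          ∫⁻ g in D ∩ {g | T < borelHeight g},
            ‖kernelClass cl i f g g - kernelBorelClass ν 𝓕 cl i f g g‖ₑ ∂νG := by
    calc ∫⁻ x, (‖(quasiSplit F E c 2).quotFun (truncatedKernelClass ν 𝓕 T cl i f) x‖ₑ : ℝ≥0∞) ∂μ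
        ≤ ∫⁻ x, (ENNReal.ofReal Cb +
            fiberLIntegral (quasiSplit F E c 2).quotientSubgroup count (Dψ ∘ fun g => g⁻¹) x) ∂μ := by
          refine lintegral_mono fun x => ?_
          rw [← hfib x, hqf x]
          exact hpt _
      _ = ENNReal.ofReal Cb * μ Set.univ +
          ∫⁻ x, fiberLIntegral (quasiSplit F E c 2).quotientSubgroup count (Dψ ∘ fun g => g⁻¹) x ∂μ := by
          rw [lintegral_add_left measurable_const, lintegral_const]
      _ = ENNReal.ofReal Cb * μ Set.univ +
          unfoldingConstant (quasiSplit F E c 2).quotientSubgroup count μ νG * ∫⁻ g, (Dψ ∘ fun g => g⁻¹) g ∂νG := by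
          have hW := LevelOrbit.lintegral_fiberLIntegral_count_eq (quasiSplit F E c 2).quotientSubgroup μ νG
            (hDψm.comp measurable_inv)
          exact congrArg (fun t => ENNReal.ofReal Cb * μ Set.univ + t) hW
      _ = ENNReal.ofReal Cb * μ Set.univ +
          unfoldingConstant (quasiSplit F E c 2).quotientSubgroup count μ νG * ∫⁻ g, Dψ g ∂νG := by
          congr 2
          exact lintegral_inv_eq_self Dψ
      _ = _ := by
          congr 2
          rw [hDψ, lintegral_indicator (hDm.inter (measurableSet_setOf_lt_borelHeight T))]
  have hfin : ∫⁻ x, (‖(quasiSplit F E c 2).quotFun (truncatedKernelClass ν 𝓕 T cl i f) x‖ₑ : ℝ≥0∞) ∂μ < ∞ := by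
    refine lt_of_le_of_lt hlin ?_
    refine ENNReal.add_lt_top.2 ⟨ENNReal.mul_lt_top ENNReal.ofReal_lt_top (measure_lt_top μ _), ?_⟩
    exact ENNReal.mul_lt_top ENNReal.coe_lt_top hDint
  exact ⟨aestronglyMeasurable_quotFun_truncatedKernelClass_two hcl hclN hfc ν h𝓕 hT0 i μ, hfin⟩

end UnitaryGroup

end Literature.NumberTheory.Automorphic
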